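import Literature.NumberTheory.EllipticCurves.SzpiroFreyProofs
import Literature.NumberTheory.DiophantineGeometry.ValuationProductElliptic
import HarnessLib

/-!
# Route RibetTakahashiSplit — glue `ValuationProductOfCurves` (stmt-ABC-1571): the two Frey models

Helper file (`--supports stmt-ABC-1571`; shared with the sibling glue A, stmt-ABC-1570) for the
Frey translation behind `Summit.ABC.ABC.Theses.RibetTakahashiSplit.ValuationProductOfCurves`:
for the global minimal integral models (12.17) `freyIntModel a b` (`16 ∤ ab(a+b)`) and (12.18)
`freyIntModel₂ A B` (`A ≡ −1 (mod 4)`, `16 ∣ B`) of the Frey–Hellegouarch curve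
(Bombieri–Gubler, Example 12.5.10; `Literature.NumberTheory.EllipticCurves.SzpiroFreyProofs`) we
prove the package

* elliptic; semistable away from `2` (resp. semistable); every odd prime of `m = |ab(a+b)|`
  divides `N` (it is a multiplicative prime); `N ∣ 2¹⁰ rad(m)` (resp. `N ∣ rad(m)`);
* `∏_{p ∣ m} v_p(m) ≤ 4 · T(W)`, `T(W) = ∏_{p ∥ N} v_p(Δ_min(W))`
  (`Literature.NumberTheory.DiophantineGeometry.multiplicativeValuationProduct`),

from three local facts — every odd `p ∣ m` is a multiplicative prime with
`v_p(Δ_min) = 2 v_p(m)`; every prime of the conductor has `v_p(Δ_min) ≥ 1`; at `2` either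
`v₂(m) ≤ 4` or `2` is multiplicative with `v₂(m) ≤ 4 v₂(Δ_min)` — combined by the elementary
`ValuationProductOfCurves.prod_factorization_le_four_mul`. The local facts are read off from
`Δ(W₀)`, `c₄(W₀)` by B–G 12.5.9 (`conductorExponent_eq_one_of_dvd_Δ_of_not_dvd_c₄`,
`conductorExponent_eq_zero_of_not_dvd_Δ` of `SzpiroLocalDataProofs`) and
`|Δ_min| = |Δ(W₀)|` (`minimalDiscriminantNorm_eq_natAbs_holds`). Everything here is proved; no
named fact is used. The closing theorem is in `RibetTakahashiSplitValuationProductOfCurves`.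

## References

* E. Bombieri, W. Gubler, *Heights in Diophantine Geometry*, New Math. Monogr. 4, CUP 2006,
  12.5.5, 12.5.9, Example 12.5.10. [BombieriGubler2006]
-/

-- `Summit.<Summit>.<Problem>` is the mandated summit-side namespace (CONVENTIONS §2); for the
-- single-conjunct summit `ABC` the two coincide, so the duplicate `ABC.ABC` is deliberate.
set_option linter.dupNamespace false

noncomputable section

namespace Summit.ABC.ABC.Theorems

open IsDedekindDomain WeierstrassCurve UniqueFactorizationMonoid Rat.HeightOneSpectrum
open Literature.NumberTheory.EllipticCurves Literature.NumberTheory.DiophantineGeometry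

/-! ## Combinatorial core -/

/-- **Combinatorial core of the Frey translation.** Let `m ≠ 0`, `F` a finite set of "multiplicative
primes" with weights `t p ≥ 1` (`p ∈ F`). If every odd prime `p ∣ m` lies in `F` with
`v_p(m) ≤ t p`, and at `2` either `v₂(m) ≤ 4` or `2 ∈ F` with `v₂(m) ≤ 4 t 2`, then
`∏_{p ∣ m} v_p(m) ≤ 4 ∏_{p ∈ F} t p`. (Pure finite-product bookkeeping: compare termwise with
`u p := [p ∈ F] t p + [p ∉ F]`, losing a factor `4` at `p = 2` only, then
`∏_{p ∣ m} u p = ∏_{p ∣ m, p ∈ F} t p` divides `∏_{p ∈ F} t p`.) [folklore] -/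
theorem ValuationProductOfCurves.prod_factorization_le_four_mul {m : ℕ} (F : Finset ℕ)
    (t : ℕ → ℕ) (hodd : ∀ p ∈ m.primeFactors, p ≠ 2 → p ∈ F ∧ m.factorization p ≤ t p)
    (hpos : ∀ p ∈ F, 1 ≤ t p)
    (htwo : m.factorization 2 ≤ 4 ∨ (2 ∈ F ∧ m.factorization 2 ≤ 4 * t 2)) :
    ∏ p ∈ m.primeFactors, m.factorization p ≤ 4 * ∏ p ∈ F, t p := by
  classical
  set u : ℕ → ℕ := fun p => if p ∈ F then t p else 1 with hu
  have hu1 : ∀ p, 1 ≤ u p := fun p => by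
    simp only [hu]
    split_ifs with h
    · exact hpos p h
    · exact le_rfl
  -- Step 1: `∏_{p ∣ m} u p ≤ ∏_{p ∈ F} t p`
  have h1 : ∏ p ∈ m.primeFactors, u p ≤ ∏ p ∈ F, t p := by
    rw [Finset.prod_ite_mem]
    refine Nat.le_of_dvd (Finset.prod_pos fun p hp => hpos p hp) ?_
    exact Finset.prod_dvd_prod_of_subset _ _ _ Finset.inter_subset_right
  -- Step 2: termwise comparison with a factor `4` at `p = 2`
  have h2 : ∏ p ∈ m.primeFactors, m.factorization p ≤
      ∏ p ∈ m.primeFactors, (if p = 2 then 4 * u p else u p) := by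
    refine Finset.prod_le_prod (fun p _ => Nat.zero_le _) fun p hp => ?_
    split_ifs with h
    · subst h
      rcases htwo with h4 | ⟨h2F, h4⟩
      · exact h4.trans (le_mul_of_one_le_right (Nat.zero_le _) (hu1 2))
      · simpa [hu, h2F] using h4
    · obtain ⟨hpF, hle⟩ := hodd p hp h
      simpa [hu, hpF] using hle
  -- Step 3: pull the factor `4` out
  have h3 : ∏ p ∈ m.primeFactors, (if p = 2 then 4 * u p else u p) ≤
      4 * ∏ p ∈ m.primeFactors, u p := by
    by_cases h2m : 2 ∈ m.primeFactors
    · rw [← Finset.mul_prod_erase _ _ h2m, ← Finset.mul_prod_erase _ (fun p => u p) h2m, if_pos rfl,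
        Finset.prod_congr rfl fun p hp => if_neg (Finset.ne_of_mem_erase hp)]
      simp only [mul_assoc]; exact le_rfl
    · rw [Finset.prod_congr rfl fun p hp => if_neg (fun h : p = 2 => h2m (h ▸ hp))]
      exact le_mul_of_one_le_left (Nat.zero_le _) (by norm_num)
  calc ∏ p ∈ m.primeFactors, m.factorization p
      ≤ ∏ p ∈ m.primeFactors, (if p = 2 then 4 * u p else u p) := h2
    _ ≤ 4 * ∏ p ∈ m.primeFactors, u p := h3
    _ ≤ 4 * ∏ p ∈ F, t p := Nat.mul_le_mul_left 4 h1

/-! ## Conductor exponents and minimal discriminant of a global minimal model over `ℤ` -/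

/-- The exponent of a rational prime `p` in the conductor `N_E ∈ ℕ` of an elliptic curve `W/ℚ`
is the local conductor exponent `f_v` at the place `v` of `ℤ` above `p`
(`factorization_conductorNorm_primesEquiv_symm`, repackaged with the place as a witness).
[folklore] -/
theorem ValuationProductOfCurves.exists_place_factorization_conductorNorm (W : WeierstrassCurve ℚ)
    [W.IsElliptic] {p : ℕ} (hp : p.Prime) :
    ∃ v : HeightOneSpectrum ℤ, natGenerator v = p ∧
      (W.conductorNorm ℤ).factorization p = W.conductorExponent v :=
  ⟨(primesEquiv (R := ℤ)).symm ⟨p, hp⟩,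
    Literature.NumberTheory.EllipticCurves.Rat.natGenerator_primesEquiv_symm ⟨p, hp⟩,
    factorization_conductorNorm_primesEquiv_symm W ⟨p, hp⟩⟩

section IntModel

variable {W₀ : WeierstrassCurve ℤ} [(W₀.baseChange ℚ).IsElliptic]

/-- For an integral model `W₀/ℤ` minimal at every prime: if `p ∤ Δ(W₀)` then `p ∤ N` (good
reduction, B–G 12.5.9(a)). [cite: BombieriGubler2006, 12.5.9(a)] -/
theorem ValuationProductOfCurves.factorization_conductorNorm_eq_zero
    (hmin : ∀ v : HeightOneSpectrum ℤ, (W₀.baseChange ℚ).IsMinimalAt v) {p : ℕ} (hp : p.Prime)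
    (hΔ : ¬ (p : ℤ) ∣ W₀.Δ) : ((W₀.baseChange ℚ).conductorNorm ℤ).factorization p = 0 := by
  obtain ⟨v, hv, hf⟩ :=
    ValuationProductOfCurves.exists_place_factorization_conductorNorm (W₀.baseChange ℚ) hp
  rw [hf]
  exact conductorExponent_eq_zero_of_not_dvd_Δ (hmin v) (by rwa [hv])

/-- For an integral model `W₀/ℤ` minimal at every prime: if `p ∣ Δ(W₀)` and `p ∤ c₄(W₀)`
(multiplicative reduction) then `p ∥ N`, i.e. `v_p(N) = 1` (B–G 12.5.9(b) with 12.5.5).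
[cite: BombieriGubler2006, 12.5.9(b)] -/
theorem ValuationProductOfCurves.factorization_conductorNorm_eq_one
    (hmin : ∀ v : HeightOneSpectrum ℤ, (W₀.baseChange ℚ).IsMinimalAt v) {p : ℕ} (hp : p.Prime)
    (hΔ : (p : ℤ) ∣ W₀.Δ) (hc₄ : ¬ (p : ℤ) ∣ W₀.c₄) :
    ((W₀.baseChange ℚ).conductorNorm ℤ).factorization p = 1 := by
  obtain ⟨v, hv, hf⟩ :=
    ValuationProductOfCurves.exists_place_factorization_conductorNorm (W₀.baseChange ℚ) hp
  rw [hf]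
  exact conductorExponent_eq_one_of_dvd_Δ_of_not_dvd_c₄ (hmin v) (by rwa [hv]) (by rwa [hv])

/-- For an integral model `W₀/ℤ` minimal at every prime: a prime of the conductor divides
`Δ(W₀)` (the conductor and the minimal discriminant have the same support, B–G 12.5.9(a),(d)).
[cite: BombieriGubler2006, 12.5.9(d)] -/
theorem ValuationProductOfCurves.dvd_Δ_of_dvd_conductorNorm
    (hmin : ∀ v : HeightOneSpectrum ℤ, (W₀.baseChange ℚ).IsMinimalAt v) {p : ℕ} (hp : p.Prime)
    (hpN : p ∣ (W₀.baseChange ℚ).conductorNorm ℤ) : (p : ℤ) ∣ W₀.Δ := by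
  by_contra hΔ
  have h0 := ValuationProductOfCurves.factorization_conductorNorm_eq_zero hmin hp hΔ
  have := hp.factorization_pos_of_dvd (conductorNorm_pos_holds _).ne' hpN
  omega

/-- For an integral model `W₀/ℤ` minimal at every prime: at a prime `p ∣ N` of bad reduction,
`v_p(Δ_min) ≥ 1` (`|Δ_min| = |Δ(W₀)|` by `minimalDiscriminantNorm_eq_natAbs_holds`, and `p ∣ Δ(W₀)`).
[cite: BombieriGubler2006, 12.5.9(d)] -/
theorem ValuationProductOfCurves.one_le_factorization_minimalDiscriminantNorm
    (hmin : ∀ v : HeightOneSpectrum ℤ, (W₀.baseChange ℚ).IsMinimalAt v) {p : ℕ} (hp : p.Prime)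
    (hpN : p ∣ (W₀.baseChange ℚ).conductorNorm ℤ) :
    1 ≤ ((W₀.baseChange ℚ).minimalDiscriminantNorm ℤ).factorization p := by
  have hΔ0 := Δ_ne_zero_of_isElliptic_baseChange_int W₀
  rw [minimalDiscriminantNorm_eq_natAbs_holds W₀ hΔ0 hmin]
  refine hp.factorization_pos_of_dvd (Int.natAbs_ne_zero.mpr hΔ0) ?_
  exact Int.natCast_dvd.mp (ValuationProductOfCurves.dvd_Δ_of_dvd_conductorNorm hmin hp hpN)

end IntModel

/-! ## The two integral Frey models -/

section ModelA

variable {a b : ℤ}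

/-- **Frey translation, model (12.17).** For coprime `a, b` with `m := |ab(a+b)| ≠ 0` and
`16 ∤ m`, the curve `W = freyIntModel a b ⊗ ℚ` (`y² = x³ + (b − a)x² − ab x`, a global minimal
model, B–G Ex. 12.5.10) is elliptic, semistable away from `2` (`f_p = [p ∣ m]` at odd `p`:
multiplicative reduction, `p ∣ Δ = 16 m²`, `p ∤ c₄ = 16(a² + ab + b²)`), has `N ∣ 2¹⁰ rad(m)`
(`conductorNorm_freyIntModel_dvd`), and `∏_{p ∣ m} v_p(m) ≤ 4 · T(W)`: at odd `p ∣ m`,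
`v_p(Δ_min) = v_p(16 m²) = 2 v_p(m)`; `v₂(m) ≤ 3`. [cite: BombieriGubler2006, Ex. 12.5.10] -/
theorem ValuationProductOfCurves.freyIntModel_package (hab : IsCoprime a b)
    (h0 : a * b * (a + b) ≠ 0) (h16 : ¬ (16 : ℤ) ∣ a * b * (a + b)) :
    ((freyIntModel a b).baseChange ℚ).IsElliptic ∧
    (∀ p : ℕ, p.Prime → p ≠ 2 → ¬ p ^ 2 ∣ ((freyIntModel a b).baseChange ℚ).conductorNorm ℤ) ∧
    (∀ p ∈ (a * b * (a + b)).natAbs.primeFactors, p ≠ 2 →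
      p ∣ ((freyIntModel a b).baseChange ℚ).conductorNorm ℤ) ∧
    ((freyIntModel a b).baseChange ℚ).conductorNorm ℤ ∣ 2 ^ 10 * radical (a * b * (a + b)).natAbs ∧
    ∏ p ∈ (a * b * (a + b)).natAbs.primeFactors, (a * b * (a + b)).natAbs.factorization p ≤
      4 * multiplicativeValuationProduct ((freyIntModel a b).baseChange ℚ) := by
  haveI := isElliptic_freyIntModel h0
  set W₀ := freyIntModel a b with hW₀
  set m := (a * b * (a + b)).natAbs with hm
  have hm0 : m ≠ 0 := Int.natAbs_ne_zero.mpr h0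
  have hmin : ∀ v : HeightOneSpectrum ℤ, (W₀.baseChange ℚ).IsMinimalAt v :=
    isMinimalAt_freyIntModel hab h0 h16
  have hΔ : W₀.Δ = 16 * (a * b * (a + b)) ^ 2 := freyIntModel_Δ a b
  have hc₄ : W₀.c₄ = 16 * (a ^ 2 + a * b + b ^ 2) := freyIntModel_c₄ a b
  set N := (W₀.baseChange ℚ).conductorNorm ℤ with hN
  have hN0 : N ≠ 0 := (conductorNorm_pos_holds _).ne'
  -- conductor exponents at the odd primes
  have hfodd : ∀ p : ℕ, p.Prime → p ≠ 2 →
      N.factorization p = if (p : ℤ) ∣ a * b * (a + b) then 1 else 0 := by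
    intro p hp hp2
    have hpint : Prime (p : ℤ) := Nat.prime_iff_prime_int.mp hp
    have hp16 : ¬ (p : ℤ) ∣ 16 := fun h => hp2 (eq_two_of_dvd_sixteen hp h)
    split_ifs with hpm
    · refine ValuationProductOfCurves.factorization_conductorNorm_eq_one hmin hp ?_ ?_
      · rw [hΔ]; exact dvd_mul_of_dvd_right (dvd_pow hpm two_ne_zero) _
      · rw [hc₄]
        intro h
        rcases hpint.dvd_or_dvd h with h | h
        · exact hp16 h
        · exact not_dvd_sq_add_mul_add_sq hab hp hpm h
    · refine ValuationProductOfCurves.factorization_conductorNorm_eq_zero hmin hp ?_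
      rw [hΔ]
      intro h
      rcases hpint.dvd_or_dvd h with h | h
      · exact hp16 h
      · exact hpm (hpint.dvd_of_dvd_pow h)
  have hss : ∀ p : ℕ, p.Prime → p ≠ 2 → ¬ p ^ 2 ∣ N := by
    intro p hp hp2 hdvd
    have h2 : 2 ≤ N.factorization p := (hp.pow_dvd_iff_le_factorization hN0).mp hdvd
    have := hfodd p hp hp2
    split_ifs at this <;> omega
  -- every odd prime of `m` is a (multiplicative) prime of the conductor
  have hdvdN : ∀ p ∈ m.primeFactors, p ≠ 2 → p ∣ N := by
    intro p hp hp2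
    have hpp := Nat.prime_of_mem_primeFactors hp
    have hf := hfodd p hpp hp2
    rw [if_pos (Int.natCast_dvd.mpr (Nat.dvd_of_mem_primeFactors hp))] at hf
    exact Nat.dvd_of_factorization_pos (by omega)
  refine ⟨inferInstance, hss, hdvdN, conductorNorm_freyIntModel_dvd hab h0 h16, ?_⟩
  have hΔ0 := Δ_ne_zero_of_isElliptic_baseChange_int W₀
  have hD : (W₀.baseChange ℚ).minimalDiscriminantNorm ℤ = 16 * m ^ 2 := by
    rw [minimalDiscriminantNorm_eq_natAbs_holds W₀ hΔ0 hmin, hΔ, Int.natAbs_mul, Int.natAbs_pow]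
    rfl
  refine ValuationProductOfCurves.prod_factorization_le_four_mul
    (N.primeFactors.filter fun p => ¬ p ^ 2 ∣ N)
    (fun p => ((W₀.baseChange ℚ).minimalDiscriminantNorm ℤ).factorization p) ?_ ?_ ?_
  · intro p hp hp2
    have hpp := Nat.prime_of_mem_primeFactors hp
    refine ⟨Finset.mem_filter.mpr
      ⟨Nat.mem_primeFactors.mpr ⟨hpp, hdvdN p hp hp2, hN0⟩, hss p hpp hp2⟩, ?_⟩
    show m.factorization p ≤ ((W₀.baseChange ℚ).minimalDiscriminantNorm ℤ).factorization p
    rw [hD, Nat.factorization_mul (by norm_num) (pow_ne_zero 2 hm0), Nat.factorization_pow]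
    simp only [Finsupp.add_apply, Finsupp.smul_apply, smul_eq_mul]
    omega
  · intro p hp
    obtain ⟨hp, -⟩ := Finset.mem_filter.mp hp
    exact ValuationProductOfCurves.one_le_factorization_minimalDiscriminantNorm hmin
      (Nat.prime_of_mem_primeFactors hp) (Nat.dvd_of_mem_primeFactors hp)
  · left
    have h4 : m.factorization 2 < 4 := by
      refine lt_of_not_ge fun hle => h16 ?_
      have h := (Nat.prime_two.pow_dvd_iff_le_factorization hm0).mpr hle
      have := Int.natCast_dvd.mpr h
      simpa using this
    omega

end ModelA

section ModelB

variable {A B : ℤ}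

/-- **Frey translation, model (12.18).** For coprime `A, B` with `m := |AB(A+B)| ≠ 0`,
`A ≡ −1 (mod 4)` and `16 ∣ B` (Serre's arrangement), the curve `W = freyIntModel₂ A B ⊗ ℚ`
(`y² + xy = x³ + ((B − A − 1)/4)x² − (AB/16)x`, a global minimal model, B–G Ex. 12.5.10 (a)) is
elliptic, semistable (`N ∣ rad(m)`, `conductorNorm_freyIntModel₂_dvd`), and
`∏_{p ∣ m} v_p(m) ≤ 4 · T(W)`: writing `B = 16 B'`, `m = 16 m'` with `m' = |AB'(A+B)|` and
`Δ(W₀) = m'²`, `c₄ = A² + AB + B²` odd and prime to `m`; every prime of `m'` is multiplicative with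
`v_p(Δ_min) = 2 v_p(m')`, which is `2 v_p(m)` at odd `p` and `2 v₂(m) − 8` at `p = 2` when
`2 ∣ m'` (i.e. `32 ∣ B`; then `v₂(m) ≤ 4 (2 v₂(m) − 8)`), while `v₂(m) = 4` if `2 ∤ m'`.
[cite: BombieriGubler2006, Ex. 12.5.10] -/
theorem ValuationProductOfCurves.freyIntModel₂_package (hAB : IsCoprime A B)
    (h0 : A * B * (A + B) ≠ 0) (hA : 4 ∣ A + 1) (hB : 16 ∣ B) :
    ((freyIntModel₂ A B).baseChange ℚ).IsElliptic ∧
    (∀ p : ℕ, p.Prime → ¬ p ^ 2 ∣ ((freyIntModel₂ A B).baseChange ℚ).conductorNorm ℤ) ∧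
    (∀ p ∈ (A * B * (A + B)).natAbs.primeFactors, p ≠ 2 →
      p ∣ ((freyIntModel₂ A B).baseChange ℚ).conductorNorm ℤ) ∧
    ((freyIntModel₂ A B).baseChange ℚ).conductorNorm ℤ ∣ radical (A * B * (A + B)).natAbs ∧
    ∏ p ∈ (A * B * (A + B)).natAbs.primeFactors, (A * B * (A + B)).natAbs.factorization p ≤
      4 * multiplicativeValuationProduct ((freyIntModel₂ A B).baseChange ℚ) := by
  obtain ⟨B', rfl⟩ := hB
  have h4 : 4 ∣ 16 * B' - A - 1 := by
    have : 16 * B' - A - 1 = 4 * (4 * B') - (A + 1) := by ring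
    rw [this]; exact dvd_sub (dvd_mul_right _ _) hA
  have h16 : 16 ∣ A * (16 * B') := ⟨A * B', by ring⟩
  haveI := isElliptic_freyIntModel₂ h0 h4 h16
  set W₀ := freyIntModel₂ A (16 * B') with hW₀
  have hmin : ∀ v : HeightOneSpectrum ℤ, (W₀.baseChange ℚ).IsMinimalAt v :=
    isMinimalAt_freyIntModel₂ hAB hA (dvd_mul_right 16 B')
  set m' : ℤ := A * B' * (A + 16 * B') with hm'
  have hfact : A * (16 * B') * (A + 16 * B') = 16 * m' := by rw [hm']; ring
  have hm'0 : m' ≠ 0 := by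
    intro h; apply h0; rw [hfact, h, mul_zero]
  have he : A * (16 * B') / 16 = A * B' := by
    rw [show A * (16 * B') = 16 * (A * B') by ring]; simp
  have hΔ : W₀.Δ = m' ^ 2 := by rw [hW₀, freyIntModel₂_Δ h4 h16, he, hm']; ring
  have hc₄ : W₀.c₄ = A ^ 2 + A * (16 * B') + (16 * B') ^ 2 := freyIntModel₂_c₄ h4 h16
  have hA2 : ¬ (2 : ℤ) ∣ A := by
    intro h
    have h2 : (2 : ℤ) ∣ A + 1 := dvd_trans ⟨2, by norm_num⟩ hA
    have := (Int.dvd_add_right h).mp h2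
    norm_num at this
  have hc₄odd : ¬ (2 : ℤ) ∣ W₀.c₄ := by
    rw [hc₄]
    intro h
    apply hA2
    have h' : A ^ 2 = (A ^ 2 + A * (16 * B') + (16 * B') ^ 2) - 2 * (8 * A * B' + 128 * B' ^ 2) := by
      ring
    have h2 : (2 : ℤ) ∣ A ^ 2 := by rw [h']; exact dvd_sub h (dvd_mul_right _ _)
    exact Int.prime_two.dvd_of_dvd_pow h2
  set N := (W₀.baseChange ℚ).conductorNorm ℤ with hN
  have hN0 : N ≠ 0 := (conductorNorm_pos_holds _).ne'
  have hNdvd : N ∣ radical (A * (16 * B') * (A + 16 * B')).natAbs :=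
    conductorNorm_freyIntModel₂_dvd hAB h0 hA (dvd_mul_right 16 B')
  have hsq : Squarefree N := squarefree_radical.squarefree_of_dvd hNdvd
  have hss : ∀ p : ℕ, p.Prime → ¬ p ^ 2 ∣ N := fun p hp h =>
    (Nat.squarefree_iff_prime_squarefree.mp hsq) p hp (by simpa [sq] using h)
  have hΔ0 := Δ_ne_zero_of_isElliptic_baseChange_int W₀
  set n := m'.natAbs with hn
  have hn0 : n ≠ 0 := Int.natAbs_ne_zero.mpr hm'0
  have hmn : (A * (16 * B') * (A + 16 * B')).natAbs = 16 * n := by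
    rw [hfact, Int.natAbs_mul]; rfl
  have hD : (W₀.baseChange ℚ).minimalDiscriminantNorm ℤ = n ^ 2 := by
    rw [minimalDiscriminantNorm_eq_natAbs_holds W₀ hΔ0 hmin, hΔ, Int.natAbs_pow]
  -- multiplicative reduction at every prime of `m'`
  have hf1 : ∀ p : ℕ, p.Prime → (p : ℤ) ∣ m' → N.factorization p = 1 := by
    intro p hp hpm
    refine ValuationProductOfCurves.factorization_conductorNorm_eq_one hmin hp ?_ ?_
    · rw [hΔ]; exact dvd_pow hpm two_ne_zero
    · rw [hc₄]
      exact not_dvd_sq_add_mul_add_sq hAB hp (by rw [hfact]; exact dvd_mul_of_dvd_right hpm _)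
  -- an odd prime of `m = 16 n` divides `n = |m'|`, hence the conductor
  have hpn : ∀ p ∈ (16 * n).primeFactors, p ≠ 2 → p ∣ n := by
    intro p hp hp2
    have hpp := Nat.prime_of_mem_primeFactors hp
    have hcop : Nat.Coprime p 16 := by
      rw [show (16 : ℕ) = 2 ^ 4 by norm_num]
      exact Nat.Coprime.pow_right _ ((Nat.coprime_primes hpp Nat.prime_two).mpr hp2)
    exact hcop.dvd_of_dvd_mul_left (Nat.dvd_of_mem_primeFactors hp)
  have hdvdN : ∀ p ∈ (16 * n).primeFactors, p ≠ 2 → p ∣ N := by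
    intro p hp hp2
    have hf := hf1 p (Nat.prime_of_mem_primeFactors hp) (Int.natCast_dvd.mpr (hpn p hp hp2))
    exact Nat.dvd_of_factorization_pos (by omega)
  rw [hmn]
  refine ⟨inferInstance, hss, hdvdN, hmn ▸ hNdvd, ?_⟩
  have h16f : (16 : ℕ).factorization 2 = 4 := by
    rw [show (16 : ℕ) = 2 ^ 4 by norm_num, Nat.prime_two.factorization_pow, Finsupp.single_eq_same]
  refine ValuationProductOfCurves.prod_factorization_le_four_mul
    (N.primeFactors.filter fun p => ¬ p ^ 2 ∣ N)
    (fun p => ((W₀.baseChange ℚ).minimalDiscriminantNorm ℤ).factorization p) ?_ ?_ ?_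
  · intro p hp hp2
    have hpp := Nat.prime_of_mem_primeFactors hp
    refine ⟨Finset.mem_filter.mpr
      ⟨Nat.mem_primeFactors.mpr ⟨hpp, hdvdN p hp hp2, hN0⟩, hss p hpp⟩, ?_⟩
    show (16 * n).factorization p ≤ ((W₀.baseChange ℚ).minimalDiscriminantNorm ℤ).factorization p
    have h16p : (16 : ℕ).factorization p = 0 := by
      refine Nat.factorization_eq_zero_of_not_dvd fun h => hp2 ?_
      rw [show (16 : ℕ) = 2 ^ 4 by norm_num] at h
      exact (Nat.prime_dvd_prime_iff_eq hpp Nat.prime_two).mp (hpp.dvd_of_dvd_pow h)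
    have hpn2 : (n ^ 2).factorization p = 2 * n.factorization p := by
      rw [Nat.factorization_pow]; rfl
    have hle : (16 * n).factorization p ≤ 2 * n.factorization p := by
      rw [Nat.factorization_mul (by norm_num) hn0, Finsupp.add_apply, h16p]
      omega
    rw [hD, hpn2]
    exact hle
  · intro p hp
    obtain ⟨hp, -⟩ := Finset.mem_filter.mp hp
    exact ValuationProductOfCurves.one_le_factorization_minimalDiscriminantNorm hmin
      (Nat.prime_of_mem_primeFactors hp) (Nat.dvd_of_mem_primeFactors hp)
  · by_cases h2 : (2 : ℤ) ∣ m'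
    · right
      have hf := hf1 2 Nat.prime_two (by exact_mod_cast h2)
      refine ⟨Finset.mem_filter.mpr ⟨Nat.mem_primeFactors.mpr
        ⟨Nat.prime_two, Nat.dvd_of_factorization_pos (by omega), hN0⟩, hss 2 Nat.prime_two⟩, ?_⟩
      have h2n' : ((2 : ℕ) : ℤ) ∣ m' := by exact_mod_cast h2
      have h2n : 1 ≤ n.factorization 2 :=
        Nat.prime_two.factorization_pos_of_dvd hn0 (Int.natCast_dvd.mp h2n')
      show (16 * n).factorization 2 ≤ 4 * ((W₀.baseChange ℚ).minimalDiscriminantNorm ℤ).factorization 2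
      rw [hD, Nat.factorization_mul (by norm_num) hn0, Nat.factorization_pow]
      simp only [Finsupp.add_apply, Finsupp.smul_apply, smul_eq_mul, h16f]
      omega
    · left
      have h2n : n.factorization 2 = 0 := by
        refine Nat.factorization_eq_zero_of_not_dvd fun h => h2 ?_
        have := Int.natCast_dvd.mpr h
        exact_mod_cast this
      rw [Nat.factorization_mul (by norm_num) hn0, Finsupp.add_apply, h16f, h2n]

end ModelB

end Summit.ABC.ABC.Theorems

end
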